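import Literature.NumberTheory.ModularForms.ModularCurveCompactification
import HarnessLib

/-!
# The cusp charts `q = e^{2πi σ_i⁻¹ z}` of `X(Γ)` and its compactness (Shimura §1.3–1.5;
# Diamond–Shurman §2.4)

Layer `Literature/NumberTheory/ModularForms`, namespace `Literature.NumberTheory.ModularForms.ModularCurve`;
sequel of `ModularCurveCompactification` (`X(Γ) = Cpt Γ`, `inl : Y(Γ) → X(Γ)`, the cusps `cuspPt i` with their
horoball neighbourhoods `cuspNhd i T`). G. Shimura, *Introduction to the arithmetic theory of automorphic
functions* (1971), §1.5 (proof of Thm. 1.28): at a cusp `s = σ∞` whose stabiliser in `Γ·{±1}` is `σ{±Tⁿ}σ⁻¹`,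
the map `z ↦ exp(2πi σ⁻¹z)` identifies `Γ_s∖{Im σ⁻¹z > 1} ∪ {s}` with the disc `|q| < e^{−2π}`; Diamond–Shurman
GTM 228, §2.4 (the charts `ψ : U → ℂ`, `ψ(π(z)) = e^{2πi δ(z)/h}`). Here the frames `σ_i` are normalised to width
`1` (`ModularCurveCuspFrames`), so no width appears.

* `cuspCoord i : X(Γ) → ℂ` — `cuspPt i ↦ 0`, `π(σ_i w) ↦ e^{2πiw}` on the sector (well defined by the sector
  lemma; junk `0` elsewhere); `cuspCoordInv i : ℂ → X(Γ)` — `0 ↦ cuspPt i`, `q ↦ π(σ_i (log q / 2πi))`;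
* `cuspChart i : OpenPartialHomeomorph (Cpt Γ) ℂ` — **the cusp chart**: source `cuspNhd i 1 = {cuspPt i} ∪
  π(σ_i{Im > 1})`, target the disc of radius `e^{−2π}`; continuity at the cusp is `e^{2πiw} → 0` as `Im w → ∞`
  (Mathlib `qParam_tendsto`), continuity of the inverse at `q₀ ≠ 0` uses the local logarithm `log(q/q₀)`;
* `instCompactSpace` — **`X(Γ)` is compact**: the image of the compact set of `ModularCurveInvariantHeight`
  carrying all points of height `≤ 2`, together with the closed cusp discs `cuspChart⁻¹{|q| ≤ e^{−4π}}`.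

Everything is proved; the definitions are the two coordinate maps and the chart; one instance
(`CompactSpace`) on the new type `Cpt Γ` only.

## References

* G. Shimura, *Introduction to the arithmetic theory of automorphic functions* (1971), §1.3, §1.5 Thm. 1.28,
  Prop. 1.29–1.31. [ShimuraIATAF1971]
* F. Diamond, J. Shurman, *A first course in modular forms*, GTM 228 (2005), §2.4 Prop. 2.4.4 and
  pp. 58–62. [DiamondShurman2005]
-/

noncomputable section

open scoped MatrixGroups Pointwise Topology Real
open Set Filter Function UpperHalfPlane Complex
open Literature.Topology.CoveringSpaces

namespace Literature.NumberTheory.ModularForms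

namespace ModularCurve

variable (Γ : Subgroup SL(2, ℤ)) [Γ.FiniteIndex]

/-! ### The coordinate `q = e^{2πi w}` on a sector -/

/-- `e^{2πi w}` is invariant under `w ↦ w + n`. [cite: DiamondShurman2005, §1.1] -/
theorem qParam_one_int_vadd (n : ℤ) (w : ℍ) :
    Function.Periodic.qParam 1 (((n : ℝ) +ᵥ w : ℍ) : ℂ) = Function.Periodic.qParam 1 (w : ℂ) := by
  rw [UpperHalfPlane.coe_vadd]
  simp only [Function.Periodic.qParam, ofReal_intCast, ofReal_one, div_one]
  rw [mul_add, Complex.exp_add]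
  have : Complex.exp (2 * π * Complex.I * (n : ℂ)) = 1 := by
    rw [show 2 * (π : ℂ) * Complex.I * n = n * (2 * π * Complex.I) by ring, Complex.exp_int_mul_two_pi_mul_I]
  rw [this, one_mul]

/-- `|e^{2πiw}| = e^{−2π Im w}` (private twin of the tree's `norm_qParam_one_eq_exp` in
`EllipticCurves/SilvermanHeightLogDiscriminantProofs`, whose heavy import closure is not wanted here). [folklore] -/
private theorem norm_qParam_one (w : ℍ) : ‖Function.Periodic.qParam 1 (w : ℂ)‖ = Real.exp (-(2 * π * w.im)) := by
  rw [Function.Periodic.norm_qParam, UpperHalfPlane.coe_im, div_one, neg_mul, neg_mul]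

/-- **The cusp coordinate on `Y(Γ)`**: `π(σ_i w) ↦ e^{2πiw}` on the sector of the `i`-th cusp (well defined:
two frame coordinates of a point of the sector differ by an integer), junk `0` off the sector.
[cite: ShimuraIATAF1971, §1.5 Thm. 1.28 (proof)] -/
def cuspCoordQ (i : Fin (numCusps Γ)) (y : Quot Γ) : ℂ := by
  classical
  exact if h : ∃ w : ℍ, 1 < w.im ∧ proj Γ (frameGL Γ i • w) = y then Function.Periodic.qParam 1 (h.choose : ℂ) else 0

/-- **The cusp coordinate is `e^{2πiw}` at `π(σ_i w)`, `Im w > 1`.** [cite: ShimuraIATAF1971, §1.5 Thm. 1.28 (proof)] -/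
theorem cuspCoordQ_proj (i : Fin (numCusps Γ)) {w : ℍ} (hw : 1 < w.im) :
    cuspCoordQ Γ i (proj Γ (frameGL Γ i • w)) = Function.Periodic.qParam 1 (w : ℂ) := by
  classical
  have h : ∃ w' : ℍ, 1 < w'.im ∧ proj Γ (frameGL Γ i • w') = proj Γ (frameGL Γ i • w) := ⟨w, hw, rfl⟩
  rw [cuspCoordQ, dif_pos h]
  obtain ⟨hw', he⟩ := h.choose_spec
  obtain ⟨γ, hγ, e⟩ := (proj_eq_iff Γ).1 he
  obtain ⟨n, hn⟩ := exists_eq_vadd_of_smul_frame_eq Γ hw hw' hγ e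
  rw [hn, qParam_one_int_vadd]

/-- Off the sector the cusp coordinate is `0` (junk). [cite: ShimuraIATAF1971, §1.5] -/
theorem cuspCoordQ_of_notMem (i : Fin (numCusps Γ)) {y : Quot Γ} (hy : y ∉ sector Γ i) : cuspCoordQ Γ i y = 0 := by
  classical
  rw [cuspCoordQ, dif_neg]
  rintro ⟨w, hw, rfl⟩
  exact hy ⟨_, ⟨w, hw, rfl⟩, rfl⟩

/-- **The cusp coordinate on `X(Γ)`**: `cuspCoordQ i` on old points, `0` at the cusps. [cite: ShimuraIATAF1971, §1.5 Thm. 1.28 (proof)] -/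
def cuspCoord (i : Fin (numCusps Γ)) : Cpt Γ → ℂ := Sum.elim (cuspCoordQ Γ i) fun _ => 0

/-- The cusp coordinate vanishes at every cusp. [cite: ShimuraIATAF1971, §1.5] -/
@[simp] theorem cuspCoord_cuspPt (i j : Fin (numCusps Γ)) : cuspCoord Γ i (cuspPt Γ j) = 0 := rfl

/-- The cusp coordinate at an old point. [cite: ShimuraIATAF1971, §1.5] -/
@[simp] theorem cuspCoord_inl (i : Fin (numCusps Γ)) (y : Quot Γ) : cuspCoord Γ i (inl Γ y) = cuspCoordQ Γ i y := rfl

/-- **`cuspCoord i (π(σ_i w)) = e^{2πiw}`** for `Im w > 1`. [cite: ShimuraIATAF1971, §1.5 Thm. 1.28 (proof)] -/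
theorem cuspCoord_inl_proj (i : Fin (numCusps Γ)) {w : ℍ} (hw : 1 < w.im) :
    cuspCoord Γ i (inl Γ (proj Γ (frameGL Γ i • w))) = Function.Periodic.qParam 1 (w : ℂ) := by
  rw [cuspCoord_inl, cuspCoordQ_proj Γ i hw]

/-- The cusp coordinate of a point of the sector is non-zero. [cite: ShimuraIATAF1971, §1.5] -/
theorem cuspCoord_inl_proj_ne_zero (i : Fin (numCusps Γ)) {w : ℍ} (hw : 1 < w.im) :
    cuspCoord Γ i (inl Γ (proj Γ (frameGL Γ i • w))) ≠ 0 := by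
  rw [cuspCoord_inl_proj Γ i hw]
  exact Function.Periodic.qParam_ne_zero _

/-! ### The inverse coordinate -/

/-- The point of `ℍ` over `q`: `log q / (2πi)` (Mathlib `invQParam 1`), as an element of `ℍ` when `|q| < 1`
(junk otherwise, via `UpperHalfPlane.ofComplex`). [cite: DiamondShurman2005, §1.1] -/
def invQ (q : ℂ) : ℍ := UpperHalfPlane.ofComplex (Function.Periodic.invQParam 1 q)

omit [Γ.FiniteIndex] in
/-- `Im (log q / 2πi) = −log|q| / 2π`. [cite: DiamondShurman2005, §1.1] -/
theorem im_invQParam_one (q : ℂ) : (Function.Periodic.invQParam 1 q).im = -(Real.log ‖q‖) / (2 * π) := by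
  rw [Function.Periodic.im_invQParam]; ring

omit [Γ.FiniteIndex] in
/-- For `0 < |q| < e^{−2πT}` the point over `q` has `Im > T`; in particular it lies in `ℍ` when `T ≥ 0`.
[cite: DiamondShurman2005, §1.1] -/
theorem lt_im_invQParam_one {q : ℂ} (hq : q ≠ 0) {T : ℝ} (hqT : ‖q‖ < Real.exp (-(2 * π * T))) :
    T < (Function.Periodic.invQParam 1 q).im := by
  rw [im_invQParam_one]
  have hqpos : 0 < ‖q‖ := norm_pos_iff.2 hq
  have hlog : Real.log ‖q‖ < -(2 * π * T) := by
    rw [← Real.exp_lt_exp, Real.exp_log hqpos]; exact hqT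
  rw [lt_div_iff₀ (by positivity)]
  linarith

omit [Γ.FiniteIndex] in
/-- The coordinate of `invQ q` for `0 < |q| < 1`. [cite: DiamondShurman2005, §1.1] -/
theorem coe_invQ {q : ℂ} (hq : q ≠ 0) (hq1 : ‖q‖ < 1) : (invQ q : ℂ) = Function.Periodic.invQParam 1 q := by
  have h0 : 0 < (Function.Periodic.invQParam 1 q).im := by
    have := lt_im_invQParam_one hq (T := 0) (by simpa using hq1)
    exact this
  rw [invQ, UpperHalfPlane.ofComplex_apply_of_im_pos h0]

omit [Γ.FiniteIndex] in
/-- `Im (invQ q) > T` for `0 < |q| < e^{−2πT}`, `T ≥ 0`. [cite: DiamondShurman2005, §1.1] -/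
theorem lt_im_invQ {q : ℂ} (hq : q ≠ 0) {T : ℝ} (hT : 0 ≤ T) (hqT : ‖q‖ < Real.exp (-(2 * π * T))) : T < (invQ q).im := by
  have hq1 : ‖q‖ < 1 := hqT.trans_le (by rw [Real.exp_le_one_iff]; nlinarith [Real.pi_pos])
  rw [← UpperHalfPlane.coe_im, coe_invQ hq hq1]
  exact lt_im_invQParam_one hq hqT

omit [Γ.FiniteIndex] in
/-- `e^{2πi invQ q} = q` for `0 < |q| < 1`. [cite: DiamondShurman2005, §1.1] -/
theorem qParam_invQ {q : ℂ} (hq : q ≠ 0) (hq1 : ‖q‖ < 1) : Function.Periodic.qParam 1 (invQ q : ℂ) = q := by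
  rw [coe_invQ hq hq1, Function.Periodic.qParam_right_inv one_ne_zero hq]

/-- **The inverse cusp coordinate** `ℂ → X(Γ)`: `0 ↦ cuspPt i`, `q ↦ π(σ_i · invQ q)` otherwise.
[cite: ShimuraIATAF1971, §1.5 Thm. 1.28 (proof)] -/
def cuspCoordInv (i : Fin (numCusps Γ)) (q : ℂ) : Cpt Γ := by
  classical
  exact if q = 0 then cuspPt Γ i else inl Γ (proj Γ (frameGL Γ i • invQ q))

/-- The inverse coordinate at `0`. [cite: ShimuraIATAF1971, §1.5] -/
@[simp] theorem cuspCoordInv_zero (i : Fin (numCusps Γ)) : cuspCoordInv Γ i 0 = cuspPt Γ i := by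
  classical
  exact if_pos rfl

/-- The inverse coordinate off `0`. [cite: ShimuraIATAF1971, §1.5] -/
theorem cuspCoordInv_of_ne_zero (i : Fin (numCusps Γ)) {q : ℂ} (hq : q ≠ 0) :
    cuspCoordInv Γ i q = inl Γ (proj Γ (frameGL Γ i • invQ q)) := by
  classical
  exact if_neg hq

/-- Two points of `ℍ` with the same `e^{2πi·}` give the same point `π(σ_i ·)` of `Y(Γ)` (they differ by an
integer, realised by `Γ` in the frame). [cite: ShimuraIATAF1971, §1.5 Thm. 1.28 (proof)] -/
theorem proj_frameGL_smul_eq_of_qParam_eq (i : Fin (numCusps Γ)) {w w' : ℍ}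
    (h : Function.Periodic.qParam 1 (w : ℂ) = Function.Periodic.qParam 1 (w' : ℂ)) :
    proj Γ (frameGL Γ i • w) = proj Γ (frameGL Γ i • w') := by
  obtain ⟨m, hm⟩ := Function.Periodic.qParam_left_inv_mod_period (h := (1 : ℝ)) one_ne_zero (w : ℂ)
  obtain ⟨m', hm'⟩ := Function.Periodic.qParam_left_inv_mod_period (h := (1 : ℝ)) one_ne_zero (w' : ℂ)
  rw [h] at hm
  -- `w = w' + (m' - m)`
  have hww' : (w : ℂ) + m = (w' : ℂ) + m' := by
    have := hm.symm.trans hm'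
    simpa only [ofReal_one, mul_one] using this
  have e : w = (((m' - m : ℤ) : ℝ) +ᵥ w' : ℍ) := by
    apply UpperHalfPlane.ext
    rw [UpperHalfPlane.coe_vadd]
    push_cast
    linear_combination hww'
  obtain ⟨γ, hγ, hγw⟩ := exists_mem_smul_frame_eq_vadd Γ i (m' - m)
  rw [e, ← hγw w', proj_smul Γ hγ]

/-! ### The cusp chart -/

/-- The radius `e^{−2π}` of the cusp disc. [cite: ShimuraIATAF1971, §1.5] -/
abbrev cuspRadius : ℝ := Real.exp (-(2 * π))

omit [Γ.FiniteIndex] in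
/-- `e^{−2π} = e^{−2π·1}` bookkeeping. [cite: ShimuraIATAF1971, §1.5] -/
theorem cuspRadius_eq : cuspRadius = Real.exp (-(2 * π * 1)) := by rw [mul_one]

/-- **Continuity of the cusp coordinate at the cusp**: `e^{2πiw} → 0` as `Im w → ∞`. [cite: ShimuraIATAF1971, §1.5 Thm. 1.28 (proof)] -/
theorem continuousAt_cuspCoord_cuspPt (i : Fin (numCusps Γ)) : ContinuousAt (cuspCoord Γ i) (cuspPt Γ i) := by
  rw [continuousAt_cuspPt_iff, cuspCoord_cuspPt]
  have hq : Tendsto (fun w : ℍ => Function.Periodic.qParam 1 (w : ℂ)) (comap UpperHalfPlane.im atTop) (𝓝 0) := by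
    have h1 := (Function.Periodic.qParam_tendsto (h := (1 : ℝ)) one_pos).mono_right nhdsWithin_le_nhds
    -- pull back along `coe : ℍ → ℂ`
    have h2 : Tendsto (fun w : ℍ => (w : ℂ)) (comap UpperHalfPlane.im atTop) (comap Complex.im atTop) := by
      rw [tendsto_comap_iff]
      exact tendsto_comap
    exact h1.comp h2
  refine hq.congr' ?_
  have hev : ∀ᶠ w : ℍ in comap UpperHalfPlane.im atTop, 1 < w.im := tendsto_comap.eventually (eventually_gt_atTop 1)
  exact hev.mono fun w hw => (cuspCoord_inl_proj Γ i hw).symm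

/-- **Continuity of the cusp coordinate on the sector** (locally it is `e^{2πi σ_i⁻¹ z}` composed with the open
quotient map `π`). [cite: ShimuraIATAF1971, §1.5 Thm. 1.28 (proof)] -/
theorem continuousAt_cuspCoord_inl (i : Fin (numCusps Γ)) {w₀ : ℍ} (hw₀ : 1 < w₀.im) :
    ContinuousAt (cuspCoord Γ i) (inl Γ (proj Γ (frameGL Γ i • w₀))) := by
  rw [← (isOpenEmbedding_inl Γ).continuousAt_iff, ← (isOpenQuotientMap_proj Γ).continuousAt_comp_iff]
  -- near `σ_i w₀` the composite is `z ↦ e^{2πi σ_i⁻¹ z}`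
  have hopen : IsOpen (frameGL Γ i • {w : ℍ | 1 < w.im}) := isOpen_frameGL_smul_setOf_lt Γ i 1
  have hmem : frameGL Γ i • w₀ ∈ frameGL Γ i • {w : ℍ | 1 < w.im} := smul_mem_smul_set hw₀
  have hev : (cuspCoord Γ i ∘ inl Γ) ∘ proj Γ =ᶠ[𝓝 (frameGL Γ i • w₀)]
      fun z => Function.Periodic.qParam 1 (((frameGL Γ i)⁻¹ • z : ℍ) : ℂ) := by
    filter_upwards [hopen.mem_nhds hmem] with z hz
    obtain ⟨w, hw, rfl⟩ := hz
    simp only [comp_apply, inv_smul_smul]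
    exact cuspCoord_inl_proj Γ i hw
  refine (ContinuousAt.congr ?_ hev.symm)
  exact ((Function.Periodic.continuous_qParam (h := (1 : ℝ))).comp
    (UpperHalfPlane.continuous_coe.comp (continuous_const_smul _))).continuousAt

/-- **Continuity of the inverse coordinate at `0`.** [cite: ShimuraIATAF1971, §1.5 Thm. 1.28 (proof)] -/
theorem continuousAt_cuspCoordInv_zero (i : Fin (numCusps Γ)) : ContinuousAt (cuspCoordInv Γ i) 0 := by
  rw [ContinuousAt, cuspCoordInv_zero, (nhds_cuspPt_hasBasis Γ i).tendsto_right_iff]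
  intro T hT
  have hpos : 0 < Real.exp (-(2 * π * T)) := Real.exp_pos _
  filter_upwards [Metric.ball_mem_nhds (0 : ℂ) hpos] with q hq
  rw [Metric.mem_ball, dist_zero_right] at hq
  by_cases hq0 : q = 0
  · rw [hq0, cuspCoordInv_zero]; exact cuspPt_mem_cuspNhd Γ i T
  · rw [cuspCoordInv_of_ne_zero Γ i hq0]
    exact inl_proj_frameGL_smul_mem_cuspNhd Γ i (lt_im_invQ hq0 (zero_le_one.trans hT) hq)

/-- **Continuity of the inverse coordinate at `q₀ ≠ 0`** (`|q₀| < 1`): near `q₀` the point `π(σ_i invQ q)` is also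
`π(σ_i L(q))` for the continuous local logarithm `L(q) = invQ q₀ + log(q/q₀)/(2πi)`.
[cite: ShimuraIATAF1971, §1.5 Thm. 1.28 (proof)] -/
theorem continuousAt_cuspCoordInv_of_ne_zero (i : Fin (numCusps Γ)) {q₀ : ℂ} (hq₀ : q₀ ≠ 0) (hq₀1 : ‖q₀‖ < 1) :
    ContinuousAt (cuspCoordInv Γ i) q₀ := by
  -- the local branch `L`
  set L : ℂ → ℂ := fun q => Function.Periodic.invQParam 1 q₀ + Function.Periodic.invQParam 1 (q / q₀) with hL
  have hLq : ∀ q, q ≠ 0 → Function.Periodic.qParam 1 (L q) = q := by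
    intro q hq
    simp only [hL, Function.Periodic.qParam, div_one, ofReal_one]
    rw [mul_add, Complex.exp_add]
    have e1 := Function.Periodic.qParam_right_inv (h := (1 : ℝ)) one_ne_zero hq₀
    have e2 := Function.Periodic.qParam_right_inv (h := (1 : ℝ)) one_ne_zero (div_ne_zero hq hq₀)
    simp only [Function.Periodic.qParam, div_one, ofReal_one] at e1 e2
    rw [e1, e2, mul_div_cancel₀ _ hq₀]
  have hLcont : ContinuousAt L q₀ := by
    refine continuousAt_const.add ?_
    simp only [Function.Periodic.invQParam]
    refine continuousAt_const.mul ?_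
    have hg : ContinuousAt Complex.log (q₀ / q₀) := by
      rw [div_self hq₀]; exact continuousAt_clog Complex.one_mem_slitPlane
    exact hg.comp (f := fun q => q / q₀) (continuousAt_id.div continuousAt_const hq₀)
  have hL₀ : L q₀ = Function.Periodic.invQParam 1 q₀ := by
    simp [hL, div_self hq₀, Function.Periodic.invQParam, Complex.log_one]
  have himL₀ : 0 < (L q₀).im := by
    rw [hL₀]; exact lt_im_invQParam_one hq₀ (T := 0) (by simpa using hq₀1)
  -- `Im (L q) > 0` near `q₀`, and there the inverse coordinate is `π(σ_i ⟨L q, _⟩)`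
  have hev_im : ∀ᶠ q in 𝓝 q₀, 0 < (L q).im :=
    (Complex.continuous_im.continuousAt.comp hLcont).eventually (lt_mem_nhds himL₀)
  have hev_ne : ∀ᶠ q in 𝓝 q₀, q ≠ 0 := isOpen_ne.mem_nhds hq₀
  have hev_lt : ∀ᶠ q in 𝓝 q₀, ‖q‖ < 1 := (continuous_norm.continuousAt (x := q₀)).eventually (gt_mem_nhds hq₀1)
  have hev : cuspCoordInv Γ i =ᶠ[𝓝 q₀] fun q => inl Γ (proj Γ (frameGL Γ i • UpperHalfPlane.ofComplex (L q))) := by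
    filter_upwards [hev_im, hev_ne, hev_lt] with q hq hq0 hq1
    rw [cuspCoordInv_of_ne_zero Γ i hq0]
    congr 1
    refine proj_frameGL_smul_eq_of_qParam_eq Γ i ?_
    rw [qParam_invQ hq0 hq1, UpperHalfPlane.ofComplex_apply_of_im_pos hq, UpperHalfPlane.coe_mk, hLq q hq0]
  refine ContinuousAt.congr ?_ hev.symm
  refine (continuous_inl Γ).continuousAt.comp ((continuous_proj Γ).continuousAt.comp
    ((continuous_const_smul _).continuousAt.comp ?_))
  -- `ofComplex ∘ L` is continuous at `q₀` (values in the open upper half-plane)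
  have h1 : ContinuousAt UpperHalfPlane.ofComplex (L q₀) :=
    UpperHalfPlane.ofComplex.continuousAt (by simpa [UpperHalfPlane.ofComplex] using himL₀)
  exact h1.comp hLcont

/-- **THE CUSP CHART** at `cuspPt i`: `{cuspPt i} ∪ π(σ_i{Im > 1}) ≃ {|q| < e^{−2π}}`, `cuspPt i ↦ 0`,
`π(σ_i w) ↦ e^{2πiw}`. [cite: ShimuraIATAF1971, §1.5 Thm. 1.28] [cite: DiamondShurman2005, §2.4 Prop. 2.4.4] -/
def cuspChart (i : Fin (numCusps Γ)) : OpenPartialHomeomorph (Cpt Γ) ℂ where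
  toFun := cuspCoord Γ i
  invFun := cuspCoordInv Γ i
  source := cuspNhd Γ i 1
  target := Metric.ball 0 cuspRadius
  map_source' := by
    intro x hx
    rw [Metric.mem_ball, dist_zero_right]
    rcases inl_or_cuspPt Γ x with ⟨y, rfl⟩ | ⟨j, rfl⟩
    · obtain ⟨w, hw, rfl⟩ := (inl_mem_cuspNhd_iff Γ).1 hx
      rw [cuspCoord_inl_proj Γ i hw, norm_qParam_one, Real.exp_lt_exp]
      nlinarith [Real.pi_pos]
    · rw [cuspCoord_cuspPt, norm_zero]; exact Real.exp_pos _
  map_target' := by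
    intro q hq
    rw [Metric.mem_ball, dist_zero_right, cuspRadius_eq] at hq
    by_cases hq0 : q = 0
    · rw [hq0, cuspCoordInv_zero]; exact cuspPt_mem_cuspNhd Γ i 1
    · rw [cuspCoordInv_of_ne_zero Γ i hq0]
      exact inl_proj_frameGL_smul_mem_cuspNhd Γ i (lt_im_invQ hq0 zero_le_one hq)
  left_inv' := by
    intro x hx
    rcases inl_or_cuspPt Γ x with ⟨y, rfl⟩ | ⟨j, rfl⟩
    · obtain ⟨w, hw, rfl⟩ := (inl_mem_cuspNhd_iff Γ).1 hx
      rw [cuspCoord_inl_proj Γ i hw, cuspCoordInv_of_ne_zero Γ i (Function.Periodic.qParam_ne_zero _)]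
      congr 1
      refine proj_frameGL_smul_eq_of_qParam_eq Γ i ?_
      exact qParam_invQ (Function.Periodic.qParam_ne_zero _) (Function.Periodic.norm_qParam_lt_one one_pos w.im_pos)
    · rw [cuspPt_mem_cuspNhd_iff] at hx
      subst hx
      rw [cuspCoord_cuspPt, cuspCoordInv_zero]
  right_inv' := by
    intro q hq
    rw [Metric.mem_ball, dist_zero_right, cuspRadius_eq] at hq
    by_cases hq0 : q = 0
    · rw [hq0, cuspCoordInv_zero, cuspCoord_cuspPt]
    · have hq1 : ‖q‖ < 1 := hq.trans_le (by rw [Real.exp_le_one_iff]; nlinarith [Real.pi_pos])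
      rw [cuspCoordInv_of_ne_zero Γ i hq0, cuspCoord_inl_proj Γ i (lt_im_invQ hq0 zero_le_one hq), qParam_invQ hq0 hq1]
  open_source := isOpen_cuspNhd Γ i le_rfl
  open_target := Metric.isOpen_ball
  continuousOn_toFun := by
    intro x hx
    refine ContinuousAt.continuousWithinAt ?_
    rcases inl_or_cuspPt Γ x with ⟨y, rfl⟩ | ⟨j, rfl⟩
    · obtain ⟨w, hw, rfl⟩ := (inl_mem_cuspNhd_iff Γ).1 hx
      exact continuousAt_cuspCoord_inl Γ i hw
    · rw [cuspPt_mem_cuspNhd_iff] at hx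
      subst hx
      exact continuousAt_cuspCoord_cuspPt Γ j
  continuousOn_invFun := by
    intro q hq
    refine ContinuousAt.continuousWithinAt ?_
    rw [Metric.mem_ball, dist_zero_right] at hq
    by_cases hq0 : q = 0
    · rw [hq0]; exact continuousAt_cuspCoordInv_zero Γ i
    · exact continuousAt_cuspCoordInv_of_ne_zero Γ i hq0 (hq.trans_le (by rw [Real.exp_le_one_iff]; nlinarith [Real.pi_pos]))

/-- The cusp chart as a function. [cite: ShimuraIATAF1971, §1.5] -/
@[simp] theorem coe_cuspChart (i : Fin (numCusps Γ)) : ⇑(cuspChart Γ i) = cuspCoord Γ i := rfl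

/-- The inverse of the cusp chart as a function. [cite: ShimuraIATAF1971, §1.5] -/
@[simp] theorem coe_cuspChart_symm (i : Fin (numCusps Γ)) : ⇑(cuspChart Γ i).symm = cuspCoordInv Γ i := rfl

/-- The source of the cusp chart. [cite: ShimuraIATAF1971, §1.5] -/
@[simp] theorem cuspChart_source (i : Fin (numCusps Γ)) : (cuspChart Γ i).source = cuspNhd Γ i 1 := rfl

/-- The target of the cusp chart. [cite: ShimuraIATAF1971, §1.5] -/
@[simp] theorem cuspChart_target (i : Fin (numCusps Γ)) : (cuspChart Γ i).target = Metric.ball 0 cuspRadius := rfl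

/-- The cusp lies in the source of its chart. [cite: ShimuraIATAF1971, §1.5] -/
theorem cuspPt_mem_cuspChart_source (i : Fin (numCusps Γ)) : cuspPt Γ i ∈ (cuspChart Γ i).source :=
  cuspPt_mem_cuspNhd Γ i 1

/-- The cusp chart sends the cusp to `0`. [cite: ShimuraIATAF1971, §1.5] -/
theorem cuspChart_cuspPt (i : Fin (numCusps Γ)) : cuspChart Γ i (cuspPt Γ i) = 0 := rfl

/-! ### `X(Γ)` is compact -/

/-- **`X(Γ)` is compact**: every point is `Γ`-equivalent to a point of height `≤ 2` (a compact set of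
representatives, `exists_isCompact_smul_mem_of_height_le`) or lies deep in a sector, i.e. in a closed cusp disc
`cuspChart⁻¹{|q| ≤ e^{−4π}}`. [cite: ShimuraIATAF1971, §1.5 Thm. 1.28 and Prop. 1.31] [cite: DiamondShurman2005, §2.4 Prop. 2.4.2] -/
instance instCompactSpace : CompactSpace (Cpt Γ) := by
  classical
  obtain ⟨K, hK, hKcov⟩ := exists_isCompact_smul_mem_of_height_le Γ 2
  -- the closed cusp discs
  set r : ℝ := Real.exp (-(2 * π * 2)) with hr
  have hr_lt : r < cuspRadius := by rw [hr, cuspRadius, Real.exp_lt_exp]; nlinarith [Real.pi_pos]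
  have hball : Metric.closedBall (0 : ℂ) r ⊆ Metric.ball 0 cuspRadius := Metric.closedBall_subset_ball hr_lt
  have hC : ∀ i, IsCompact ((cuspChart Γ i).symm '' Metric.closedBall 0 r) := fun i =>
    (isCompact_closedBall 0 r).image_of_continuousOn ((cuspChart Γ i).continuousOn_symm.mono (by
      rw [cuspChart_target]; exact hball))
  refine ⟨?_⟩
  have hcov : (univ : Set (Cpt Γ)) ⊆ (inl Γ ∘ proj Γ) '' K ∪ ⋃ i, (cuspChart Γ i).symm '' Metric.closedBall 0 r := by
    intro x _
    rcases inl_or_cuspPt Γ x with ⟨y, rfl⟩ | ⟨i, rfl⟩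
    · obtain ⟨z, rfl⟩ := proj_surjective Γ y
      by_cases hz : height Γ z ≤ 2
      · obtain ⟨γ, hγ, hγz⟩ := hKcov z hz
        exact Or.inl ⟨γ • z, hγz, by simp [proj_smul Γ hγ]⟩
      · push Not at hz
        obtain ⟨γ, hγ, i, w, hw, e⟩ := exists_smul_eq_frameGL_smul_of_lt_height Γ (by norm_num) hz
        refine Or.inr (mem_iUnion.2 ⟨i, ?_⟩)
        have hw1 : 1 < w.im := lt_trans (by norm_num) hw
        have hx : inl Γ (proj Γ z) = inl Γ (proj Γ (frameGL Γ i • w)) := by rw [← e, proj_smul Γ hγ]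
        refine ⟨cuspCoord Γ i (inl Γ (proj Γ z)), ?_, ?_⟩
        · rw [hx, cuspCoord_inl_proj Γ i hw1, Metric.mem_closedBall, dist_zero_right, norm_qParam_one, hr,
            Real.exp_le_exp]
          nlinarith [Real.pi_pos]
        · have hsrc : inl Γ (proj Γ z) ∈ (cuspChart Γ i).source := by rw [hx]; exact inl_proj_frameGL_smul_mem_cuspNhd Γ i hw1
          exact (cuspChart Γ i).left_inv hsrc
    · refine Or.inr (mem_iUnion.2 ⟨i, ⟨0, by simp [hr, (Real.exp_pos _).le], ?_⟩⟩)
      rw [coe_cuspChart_symm, cuspCoordInv_zero]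
  exact ((hK.image ((continuous_inl Γ).comp (continuous_proj Γ))).union (isCompact_iUnion hC)).of_isClosed_subset
    isClosed_univ hcov

/-- Every point of `X(Γ)` is an old point or lies in the source of a cusp chart. [cite: ShimuraIATAF1971, §1.5] -/
theorem mem_range_inl_or_mem_cuspChart_source (x : Cpt Γ) : x ∈ range (inl Γ) ∨ ∃ i, x ∈ (cuspChart Γ i).source := by
  rcases inl_or_cuspPt Γ x with ⟨y, rfl⟩ | ⟨i, rfl⟩
  · exact Or.inl (mem_range_self y)
  · exact Or.inr ⟨i, cuspPt_mem_cuspChart_source Γ i⟩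

end ModularCurve

end Literature.NumberTheory.ModularForms

end
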